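import Summits.Langlands.Langlands.Theorems.IrreducibilityBySelfDualityIrreducibleOffSectorRankTwoRegular
import Summits.Langlands.Langlands.Theorems.IrreducibilityBySelfDualityIrreducibleOffSectorIsobaricRigidityOfRank
import Literature.NumberTheory.Automorphic.PairLFunctionPolesRepDataHolds
import HarnessLib

/-!
# `IrreducibleOffSector` in rank two for regular `π` — without the Arthur–Clozel (2.3) input
(crux stmt-Langlands-14329 `IrreducibilityBySelfDuality.IrreducibleOffSector`, line `Sketch`;
`--supports` file, STRUCTURAL: no import of the route module)

`isIrreducible_rank_two_of_isRegular` (p113499) settles the rank-two regular region of the crux modulo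
the texts of `WeakAbelianSummandHecke` (Böckle–Hui Thm. 1.1, a theorem of the tree),
`HeckeEigenvalueField` (Clozel 3.13), Arthur–Clozel (2.2) AND the all-ranks named fact Arthur–Clozel
(2.3).  The last input is idle: the isobaric rigidity it feeds compares `π` on `GL_2` with a sum of
two Hecke characters, where (2.3) is needed only for pairs of cuspidal data on `GL_1(𝔸_K)` — a
THEOREM of the tree (`JacquetShalika1981_partialPairL_pole_repData_one`: the simple pole of twisted
partial Dedekind zeta functions, Hecke).  With the rank-local rigidity `isobaricRigidity_of_JS_of_rank`
this file proves the same statement from `WeakAbelianSummandHecke`, `HeckeEigenvalueField` and (2.2)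
alone (`isIrreducible_rank_two_of_isRegular_of_boundary`); the argument is otherwise that of
`…IrreducibleOffSectorRankTwoRegular` (semisimplification, `E`-rationality through the regular
algebraic twist, block characters, Böckle–Hui's GL(1) data, rigidity).

References: G. Böckle, C. Y. Hui (2025), Thm. 1.1 and §3.2.1; H. Jacquet, J. Shalika, Amer. J. Math.
103 (1981) II, Thm. 4.4; E. Hecke (1917/1920), residue of `ζ_K` (through the tree's
`JacquetShalika1981_partialPairL_pole_of_eq_conj_one`).
-/

noncomputable section

set_option linter.dupNamespace false

open scoped NumberField Classical Polynomial
open Filter IsDedekindDomain Polynomial NumberField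
open Literature.NumberTheory.Automorphic Literature.NumberTheory.GaloisRepresentations
open Summit.Langlands

namespace Summit.Langlands.Langlands.Theorems.IrreducibleOffSector

/-- **`IrreducibleOffSector` in rank two for regular `π`, from Böckle–Hui Thm. 1.1 (GL(1) form),
Clozel's Hecke field and Arthur–Clozel (2.2) only.**  For every number field `K`, every cuspidal `π`
on `GL_2(𝔸_K)` that is L-algebraic with a regular infinity type, every `ℓ`, `ι` and every
`ρ : Γ_K → GL_2(ℚ̄_ℓ)` Satake–Frobenius compatible with `(π, ι)` at almost all places, `ρ` is
irreducible.  (The (2.3) input of `isIrreducible_rank_two_of_isRegular` is discharged in rank one by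
`JacquetShalika1981_partialPairL_pole_repData_one`.)
[cite: BockleHui2025, Theorem 1.1 and §3.2.1] [cite: JacquetShalikaAJM1981II, Thm. 4.4] -/
theorem isIrreducible_rank_two_of_isRegular_of_boundary
    (hWA : ∀ (K : Type) [Field K] [NumberField K] (h1 : isCompact_glFiniteIntegralLevel 1 K) (ℓ : ℕ) [Fact ℓ.Prime] (n : ℕ) (E : Type) [Field E] [NumberField E] (e : E →+* PadicAlgCl ℓ) (ρ : Literature.NumberTheory.GaloisRepresentations.FramedGaloisRep K (PadicAlgCl ℓ) n), ρ.toGaloisRep.IsSemisimple → (∀ᶠ v in cofinite, ρ.IsUnramifiedAt v ∧ ∃ P : Polynomial E, ρ.HasFrobCharpolyAt v (P.map e)) → ∀ (ψ : Literature.NumberTheory.GaloisRepresentations.FramedGaloisRep K (PadicAlgCl ℓ) 1), (∀ᶠ v in cofinite, ρ.IsUnramifiedAt v ∧ ψ.IsUnramifiedAt v ∧ ∀ 𝔓 ∈ v.primesAbove, ∀ σ : Field.absoluteGaloisGroup K, IsArithFrobAt (NumberField.RingOfIntegers K) σ 𝔓 → ψ.charpoly σ ∣ ρ.charpoly σ)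 → ∀ (ι : PadicAlgCl ℓ ≃+* ℂ), ∃ χ : Literature.NumberTheory.Automorphic.CuspidalAutomorphicRepData 1 K h1, χ.1.IsRegularAlgebraic ∧ ∀ᶠ v in cofinite, ∃ c : ℂ, χ.1.HasSatakeParamAt v {c} ∧ ψ.IsUnramifiedAt v ∧ ψ.HasFrobCharpolyAt v (Literature.NumberTheory.Automorphic.arithFrobPolyOfSatake ι v.residueCard 1 {c}))
    (hHE : ∀ (n : ℕ) (K : Type) [Field K] [NumberField K] (hcpt : Literature.NumberTheory.Automorphic.isCompact_glFiniteIntegralLevel n K) (π : Literature.NumberTheory.Automorphic.CuspidalAutomorphicRepData n K hcpt), π.1.IsRegularAlgebraic → ∃ E : Subfield ℂ, FiniteDimensional ℚ E ∧ ∀ᶠ v in cofinite, ∀ α : Multiset ℂ, π.1.HasSatakeParamAt v α → ∀ i ≤ n, ((((Real.sqrt (v.residueCard : ℝ)) : ℝ) : ℂ) ^ (i * (n - i))) * α.esymm i ∈ E)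
    (h22 : JacquetShalika1981_partialPairL_boundary_repData)
    {K : Type} [Field K] [NumberField K] {hcpt : isCompact_glFiniteIntegralLevel 2 K}
    (π : CuspidalAutomorphicRepData 2 K hcpt) (hL : π.1.IsLAlgebraic)
    (hreg : ∃ T : InfinityType K 2, π.1.HasInfinityType T ∧ T.IsRegular)
    {ℓ : ℕ} [Fact ℓ.Prime] (ι : PadicAlgCl ℓ ≃+* ℂ) (ρ : FramedGaloisRep K (PadicAlgCl ℓ) 2)
    (hρ : ∀ᶠ v : HeightOneSpectrum (𝓞 K) in cofinite, SatakeFrobCompatibleAt ι π.1 ρ v) :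
    ρ.toGaloisRep.IsIrreducible := by
  haveI : NeZero (2 : ℕ) := ⟨two_ne_zero⟩
  -- a regular L-algebraic infinity type of `π` (regularity only reads the `a`-multisets)
  obtain ⟨T, hT, hTL, hTR⟩ :
      ∃ T : InfinityType K 2, π.1.HasInfinityType T ∧ T.IsLAlgebraic ∧ T.IsRegular := by
    obtain ⟨T₁, hT₁, hL₁⟩ := hL
    obtain ⟨T₂, hT₂, hR₂⟩ := hreg
    refine ⟨T₁, hT₁, hL₁, fun σ => ?_⟩
    rw [AutomorphicRepData.HasInfinityType.map_a_eq π.1 hT₁ hT₂ σ]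
    exact hR₂ σ
  -- the regular algebraic twist `π' = π ⊗ |det|^{1/2}` and Clozel's Hecke field of `π'`
  obtain ⟨χ, π', hχ, hW, hW', hT'⟩ := π.exists_twist_hasInfinityType (((2 : ℝ) - 1) / 2) hT
  have hRA : π'.1.IsRegularAlgebraic := isRegularAlgebraic_of_hasInfinityType_twist_half hT' hTL hTR
  obtain ⟨E, hfd, hE⟩ := hHE 2 K hcpt π' hRA
  haveI : FiniteDimensional ℚ E := hfd
  haveI : NumberField E := NumberField.mk
  -- it suffices to treat semisimple avatars
  refine isIrreducible_of_forall_isSemisimple π.1 ι (fun r hss hr => ?_) ρ hρ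
  by_contra hirr
  have h1 : isCompact_glFiniteIntegralLevel 1 K := isCompact_glFiniteIntegralLevel_holds 1 K
  -- `E`-rationality of `r`, and its two characters
  have hrat := eventually_rational_rank_two ι hχ hW hW' E hE r hr
  obtain ⟨A, D, hcp, hur⟩ := exists_blocks_of_not_isIrreducible_two r hirr
  have hrunr : ∀ᶠ v : HeightOneSpectrum (𝓞 K) in cofinite, r.IsUnramifiedAt v :=
    hr.mono fun v hv => hv.choose_spec.2.1
  have hdivA : ∀ᶠ v : HeightOneSpectrum (𝓞 K) in cofinite, r.IsUnramifiedAt v ∧ A.IsUnramifiedAt v ∧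
      ∀ 𝔓 ∈ v.primesAbove, ∀ σ : Field.absoluteGaloisGroup K, IsArithFrobAt (𝓞 K) σ 𝔓 →
        A.charpoly σ ∣ r.charpoly σ :=
    hrunr.mono fun v hv => ⟨hv, (hur v hv).1, fun 𝔓 _ σ _ => ⟨D.charpoly σ, hcp σ⟩⟩
  have hdivD : ∀ᶠ v : HeightOneSpectrum (𝓞 K) in cofinite, r.IsUnramifiedAt v ∧ D.IsUnramifiedAt v ∧
      ∀ 𝔓 ∈ v.primesAbove, ∀ σ : Field.absoluteGaloisGroup K, IsArithFrobAt (𝓞 K) σ 𝔓 →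
        D.charpoly σ ∣ r.charpoly σ :=
    hrunr.mono fun v hv => ⟨hv, (hur v hv).2, fun 𝔓 _ σ _ => ⟨A.charpoly σ, by rw [hcp σ, mul_comm]⟩⟩
  -- Böckle–Hui Thm 1.1 in GL(1) form: both characters are attached to cuspidal GL(1) data
  obtain ⟨χA, -, hχA⟩ := hWA K h1 ℓ 2 E ((ι.symm : ℂ ≃+* PadicAlgCl ℓ).toRingHom.comp E.subtype)
    r hss hrat A hdivA ι
  obtain ⟨χD, -, hχD⟩ := hWA K h1 ℓ 2 E ((ι.symm : ℂ ≃+* PadicAlgCl ℓ).toRingHom.comp E.subtype)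
    r hss hrat D hdivD ι
  -- isobaric rigidity for `GL₂` versus `GL₁ ⊞ GL₁`, (2.3) in rank one being Hecke's theorem
  refine (isobaricRigidity_of_JS_of_rank h22 K 2 hcpt two_pos π 2 (fun _ => 1) (fun _ => h1)
    (fun _ τ τ' => JacquetShalika1981_partialPairL_pole_repData_one h1 τ τ')
    (fun i => ![χA, χD] i) le_rfl (fun _ => one_pos) ?_).elim
  filter_upwards [hr, hχA, hχD] with v hv hvA hvD
  intro α hα
  obtain ⟨α₀, hα₀, -, hcpv⟩ := hv
  obtain rfl : α = α₀ := AutomorphicRepData.hasSatakeParamAt_unique_holds π.1 hα hα₀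
  obtain ⟨c, hc, -, hcpA⟩ := hvA
  obtain ⟨d, hd, -, hcpD⟩ := hvD
  refine ⟨![{c}, {d}], Fin.forall_fin_two.2 ⟨hc, hd⟩, ?_⟩
  -- the Frobenius polynomial of `r` is the product of those of `A` and `D`
  have hprod : r.HasFrobCharpolyAt v
      (arithFrobPolyOfSatake ι v.residueCard 1 {c} * arithFrobPolyOfSatake ι v.residueCard 1 {d}) := by
    intro 𝔓 h𝔓 τ hτ
    rw [hcp τ, hcpA 𝔓 h𝔓 τ hτ, hcpD 𝔓 h𝔓 τ hτ]
  rw [← arithFrobPolyOfSatake_add] at hprod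
  have heq : arithFrobPolyOfSatake ι v.residueCard 1 α =
      arithFrobPolyOfSatake ι v.residueCard 1 ({c} + {d}) :=
    GaloisRep.HasFrobCharpolyAt.unique_holds
      ((FramedGaloisRep.hasFrobCharpolyAt_toGaloisRep_iff v _ r).mpr hcpv)
      ((FramedGaloisRep.hasFrobCharpolyAt_toGaloisRep_iff v _ r).mpr hprod)
  rw [arithFrobPolyOfSatake_one_injective ι _ heq, Fin.sum_univ_two]
  rfl

end Summit.Langlands.Langlands.Theorems.IrreducibleOffSector

end
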